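import Literature.IUT.HodgeArakelov.MonoThetaFromGroups
import Literature.IUT.HodgeArakelov.MonoThetaCyclotomesBridge
import Literature.IUT.HodgeArakelov.ModelReconstruction
import Literature.AnabelianGeometry.EtaleTheta.ThetaRigidityLevels
import Literature.AnabelianGeometry.EtaleTheta.Discharge.Sec2RigidityProofs
import Literature.AnabelianGeometry.EtaleTheta.Discharge.Sec2LiftingProofs
import Literature.AnabelianGeometry.EtaleTheta.Discharge.Sec2FibreCardinality

/-!
# [IUTchII] §1, Proposition 1.2 (i), (ii) — discharge (proof-only companion of `MonoThetaFromGroups`)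

Mochizuki, *Inter-universal Teichmüller theory II*, §1, Proposition 1.2 (i) (kurims p. 25), (ii) (pp. 25–26)
[claim: Mochizuki2012, status: disputed] (IUTchII §1 Prop 1.2, kurims pp.25-26). DAG nodes `IUTchII:Prop1.2(i)`,
`IUTchII:Prop1.2(ii)` (abc-iut cell, cone of [IUTchIII] Cor. 3.12; seat abc-iut-w4-d008). PROOF-ONLY companion of
abc-iut-L6-t1's `MonoThetaFromGroups.lean` (p406189; nothing there is edited or restated): no `def`, no new named
fact. Printed proof (p. 26): "The assertions of Proposition 1.2 follow immediately from the results of [EtTh] that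
are quoted in the statements of these assertions." — the results quoted being [EtTh] Cor. 2.18 (ii), (iv) for (i)
and [EtTh] Thm. 5.10 (iii) for (ii) (whose statement also cites [FrdI] Cor. 4.11, (ii), (iv) and [EtTh] Prop. 5.1
for the Frobenioid structure of `𝒞`). (v2: proof sentence and page corrected — referee lane P, #136, F5.)

What the typer left to prove. `MonoThetaFromGroups` types Prop. 1.2 (i) as the OUTPUT structure `EnvOfGroup S P`
(`M^Θ(Π)`, its Def. 1.1 (i) output, the functorial isomorphism `Π ≅ Π_X(M^Θ(Π))`) plus the PREDICATE
`Prop12_i_indeterminacy R` on a Def. 1.1 (i) output `R` ("the isomorphism indeterminacy of `M^Θ(Π)` is with respect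
to a group of `μ_N`-conjugacy classes of automorphisms which is of order `1` (resp. `2`) if `N` is odd (resp. even)
[cf. [EtTh], Corollary 2.18, (iv)]"), and Prop. 1.2 (ii) as the OUTPUT structure `EnvOfFrobenioid F`. This file:

* `prop12_i_indeterminacy_of_modelIso` — **the indeterminacy clause of Prop. 1.2 (i) DISCHARGED modulo the named
  [EtTh] fact `ThetaEnvData.Cor218_iv_fibre`** (Cor. 2.18 (iv), fibres; FACT-policy node `EtTh:Cor2.18(iv)` of the
  cell, consumed BY NAME): for every [IUTchII]-typed mono-theta environment `M` of a setting `S` identified with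
  L2's [EtTh] Def. 2.13 (ii) model `T.modelMono η` (`ε : M.toEtale.Iso (T.modelMono η)`, bridge B8
  `MonoThetaCyclotomesBridge`), and every Def. 1.1 (i) output `R` of `M` whose quotient `Π_M ↠ Π_Y(M)` has the
  kernel of the model's `Π^tp_Y[μ_N] ↠ Π^tp_Y` (this covers abc-iut-L6-d6's `ModelFrame.reconstruction`,
  `prop12_i_indeterminacy_reconstruction`), the automorphisms of `M` inducing the identity on `Π_Y(M)` form exactly
  `1` (`N` odd) resp. `2` (`N` even) `μ_N`-conjugacy classes. Route (= [EtTh] p. 63): by Cor. 2.18 (iv) such an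
  automorphism is a `μ_N`-conjugate of the twist by some `φ ∈ Hom(Π^tp_Y/Π^tp_Ÿ, μ_N)`; conversely every twist IS
  an automorphism (L2's PROVED `ThetaEnvData.exists_iso_eq_twist`); `Hom(Π^tp_Y/Π^tp_Ÿ, μ_N) ≅ μ_N[2]` has `1` resp.
  `2` elements (`[Π^tp_Y : Π^tp_Ÿ] = 2`, `μ_N` cyclic of order `N`); and twists by DISTINCT `φ` are never
  `μ_N`-conjugate (the quotient cocycle would be the coboundary of an element of `μ_N` fixed by `Π^tp_Ÿ`, hence —
  `Π^tp_Ÿ ↠ G_K` — by `G_K`, hence trivial). The [EtTh]-side group theory (`ThetaEnvData.homKill_eq_one_of_odd`,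
  `.homKill_eq_one_or_eq`, `.eq_of_conj_twist_eq`) is the companion
  `Literature/AnabelianGeometry/EtaleTheta/Discharge/Sec2FibreCardinality.lean` (same seat).
* `exists_envOfGroup` — **the Prop. 1.2 (i) OUTPUT EXHIBITED** over abc-iut-L6-d6's `ModelFrame S R` (bridge B8 part
  5b): for every topological group `Π ≅ Π^tp_{X̲̲_k}` and every mono-theta environment `M` of `S`, an
  `EnvOfGroup S Π` with `M^Θ(Π) = M` whose Def. 1.1 (i) output satisfies `Prop12_i_indeterminacy` (modulo
  `RigidData.Cor218_iv_fibre`); `exists_envOfGroup_of_prop214_i` — the same modulo [EtTh] Prop. 2.14 (i) instead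
  (L2's `RigidData.cor218_iv_fibre_of_prop214_i`).
* `exists_envOfFrobenioid` — **the Prop. 1.2 (ii) OUTPUT EXHIBITED** over a `ModelFrame`, for every instance of the
  typer's interface `TemperedFrobenioidData S` (`𝒟 ≅ B^temp(Π_X(M^Θ(𝒞)))⁰` by transporting the interface equivalence
  `𝒟 ≌ B^temp(Π^tp_{X̲̲_k})⁰` along `Π^tp_{X̲̲_k} ≅ Π_X(M)`). HONEST NOTE: as the typer's docstring records (review of
  p405599), over this interface the output carries no further property clause; the Frobenioid-theoretic CONTENT of
  Prop. 1.2 (ii) is [EtTh] Thm. 5.10 (iii) (node `EtTh:Thm5.10(iii)`, layer L2), not re-proved here.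

HONEST FRAMING: kernel-checked implications between typed statements of a disputed corpus (claim key `Mochizuki2012`,
D-0012) and the named facts of a refereed source [cite: MochizukiEtTh2009, Cor 2.18(iv) p.61]; nothing here asserts a
disputed claim or takes a side on [IUTchIII] Cor. 3.12; typed ≠ discharged elsewhere.
-/

namespace Literature.IUT.HodgeArakelov

universe u

open Literature.AnabelianGeometry.EtaleTheta
open scoped Literature.AnabelianGeometry.EtaleTheta
open MonoThetaBridge

/-! ## Transfer to an [IUTchII]-typed mono-theta environment identified with the [EtTh] model -/

section Model

variable {S : ThetaSetting.{u}} {T : ThetaEnvData.{u} S.N} {η : T.PiYdd → T.mu} {hη : η ∈ T.thetaCocycles}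
  {M : MonoThetaEnv S}

/-- Every twist of the model by `φ ∈ Hom(Π^tp_Y/Π^tp_Ÿ, μ_N)` is (read through `ε`) an automorphism of the
[IUTchII]-typed mono-theta environment `M` ([EtTh] Cor. 2.18 (iv), fibres, existence half — L2's PROVED
`ThetaEnvData.exists_iso_eq_twist` — transported along bridge B8). [cite: MochizukiEtTh2009, Cor 2.18(iv) p.63] -/
theorem exists_iso_twist (ε : M.toEtale.Iso (T.modelMono hη)) (φ : T.PiY →* T.mu)
    (hφ : ∀ d : T.PiYdd, φ (T.inclYdd d) = 1) :
    ∃ τ : MonoThetaEnv.Iso M M, ∀ y : M.Pi,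
      ε.e (τ.iso y) =
        CycEnvelope.inMu T.augY T.chi (φ (CycEnvelope.proj T.augY T.chi (ε.e y))) * ε.e y := by
  obtain ⟨β, hβ⟩ := T.exists_iso_eq_twist hη φ hφ
  refine ⟨MonoThetaEnv.Iso.ofEtale (etaleIsoTrans (etaleIsoTrans ε β) (etaleIsoSymm ε)), fun y => ?_⟩
  change ε.e (ε.e.symm (β.e (ε.e y))) = _
  rw [ContinuousMulEquiv.apply_symm_apply, hβ]

/-- Every automorphism of the [IUTchII]-typed `M` is (read through `ε`) an automorphism of the [EtTh] model
(bridge B8: `Iso.toEtale` composed with `ε`). [cite: MochizukiEtTh2009, Def 2.13(ii) p.48] -/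
theorem exists_modelIso (ε : M.toEtale.Iso (T.modelMono hη)) (α : MonoThetaEnv.Iso M M) :
    ∃ β : (T.modelMono hη).Iso (T.modelMono hη), ∀ x : T.env, β.e x = ε.e (α.iso (ε.e.symm x)) :=
  ⟨etaleIsoTrans (etaleIsoTrans (etaleIsoSymm ε) α.toEtale) ε, fun _ => rfl⟩

variable (Rc : Reconstruction M)

/-- For a Def. 1.1 (i) output `R` of `M` whose `Π_M ↠ Π_Y(M)` has the model's kernel: `R.projY a = R.projY b` iff
`ε a`, `ε b` have the same image in `Π^tp_Y`. [claim: Mochizuki2012, status: disputed] (IUTchII §1 Def 1.1 (i), kurims p.21) -/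
theorem projY_eq_iff (ε : M.toEtale.Iso (T.modelMono hη))
    (hker : ∀ x : M.Pi, Rc.projY x = 1 ↔ CycEnvelope.proj T.augY T.chi (ε.e x) = 1) (a b : M.Pi) :
    Rc.projY a = Rc.projY b ↔
      CycEnvelope.proj T.augY T.chi (ε.e a) = CycEnvelope.proj T.augY T.chi (ε.e b) := by
  have h1 : Rc.projY a = Rc.projY b ↔ Rc.projY (a * b⁻¹) = 1 := by
    rw [map_mul, map_inv, mul_inv_eq_one]
  have h2 : CycEnvelope.proj T.augY T.chi (ε.e (a * b⁻¹)) = 1 ↔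
      CycEnvelope.proj T.augY T.chi (ε.e a) = CycEnvelope.proj T.augY T.chi (ε.e b) := by
    rw [map_mul, map_inv, map_mul, map_inv, mul_inv_eq_one]
  exact h1.trans ((hker _).trans h2)

/-- An element of the exterior cyclotome `Π_μ(M) = Ker(Π_M ↠ Π_Y(M))` of such an output is (read through `ε`) an
element of `μ_N ⊆ Π^tp_Y[μ_N]`. [claim: Mochizuki2012, status: disputed] (IUTchII §1 Def 1.1 (i), kurims p.21) -/
theorem exists_inMu_eq_of_projY_eq_one (ε : M.toEtale.Iso (T.modelMono hη))
    (hker : ∀ x : M.Pi, Rc.projY x = 1 ↔ CycEnvelope.proj T.augY T.chi (ε.e x) = 1) {m : M.Pi}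
    (hm : Rc.projY m = 1) : ∃ c : T.mu, CycEnvelope.inMu T.augY T.chi c = ε.e m := by
  have h : ε.e m ∈ (CycEnvelope.proj T.augY T.chi).ker := (hker m).mp hm
  rw [CycEnvelope.ker_proj_eq_range_inMu] at h
  exact h

/-- Conversely `ε⁻¹(μ_N) ⊆ Π_μ(M)`. [claim: Mochizuki2012, status: disputed] (IUTchII §1 Def 1.1 (i), kurims p.21) -/
theorem projY_symm_inMu (ε : M.toEtale.Iso (T.modelMono hη))
    (hker : ∀ x : M.Pi, Rc.projY x = 1 ↔ CycEnvelope.proj T.augY T.chi (ε.e x) = 1) (c : T.mu) :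
    Rc.projY (ε.e.symm (CycEnvelope.inMu T.augY T.chi c)) = 1 := by
  rw [hker, ContinuousMulEquiv.apply_symm_apply]
  exact SemidirectProduct.rightHom_inl c

/-- A twist automorphism of `M` induces the identity on `Π_Y(M)`.
[claim: Mochizuki2012, status: disputed] (IUTchII §1 Prop 1.2 (i), kurims p.25) -/
theorem projY_twist (ε : M.toEtale.Iso (T.modelMono hη))
    (hker : ∀ x : M.Pi, Rc.projY x = 1 ↔ CycEnvelope.proj T.augY T.chi (ε.e x) = 1) {φ : T.PiY →* T.mu}
    {τ : MonoThetaEnv.Iso M M}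
    (hτ : ∀ y : M.Pi, ε.e (τ.iso y) =
      CycEnvelope.inMu T.augY T.chi (φ (CycEnvelope.proj T.augY T.chi (ε.e y))) * ε.e y)
    (x : M.Pi) : Rc.projY (τ.iso x) = Rc.projY x := by
  rw [projY_eq_iff Rc ε hker, hτ, map_mul, SemidirectProduct.rightHom_inl, one_mul]

/-- An automorphism `α` of `M` which reads, through `ε`, as the `μ_N`-conjugate by `c` of the twist by `φ` is
`μ_N`-conjugate (in the sense `MuConjugate` of the typer) to the twist automorphism `τ` of `M` by `φ`.
[claim: Mochizuki2012, status: disputed] (IUTchII §1 Prop 1.2 (i), kurims p.25) -/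
theorem muConjugate_twist (ε : M.toEtale.Iso (T.modelMono hη))
    (hker : ∀ x : M.Pi, Rc.projY x = 1 ↔ CycEnvelope.proj T.augY T.chi (ε.e x) = 1) {φ : T.PiY →* T.mu}
    {τ : MonoThetaEnv.Iso M M}
    (hτ : ∀ y : M.Pi, ε.e (τ.iso y) =
      CycEnvelope.inMu T.augY T.chi (φ (CycEnvelope.proj T.augY T.chi (ε.e y))) * ε.e y)
    {α : MonoThetaEnv.Iso M M} {c : T.mu}
    (hα : ∀ y : M.Pi, ε.e (α.iso y) =
      MulAut.conj (CycEnvelope.inMu T.augY T.chi c)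
        (CycEnvelope.inMu T.augY T.chi (φ (CycEnvelope.proj T.augY T.chi (ε.e y))) * ε.e y)) :
    MuConjugate Rc τ α := by
  refine ⟨⟨ε.e.symm (CycEnvelope.inMu T.augY T.chi c), projY_symm_inMu Rc ε hker c⟩, fun y => ?_⟩
  apply ε.e.injective
  change ε.e (α.iso y) =
    ε.e (ε.e.symm (CycEnvelope.inMu T.augY T.chi c) * τ.iso y * (ε.e.symm (CycEnvelope.inMu T.augY T.chi c))⁻¹)
  rw [map_mul, map_mul, map_inv, ContinuousMulEquiv.apply_symm_apply, hτ, hα, MulAut.conj_apply]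

/-- Two twist automorphisms of `M` (by `φ`, `ψ ∈ Hom(Π^tp_Y/Π^tp_Ÿ, μ_N)`) that are both `μ_N`-conjugate to one
automorphism `α` have `φ = ψ`. [cite: MochizukiEtTh2009, Cor 2.18(iv) p.63] -/
theorem eq_of_muConjugate_twist (haug : Function.Surjective (T.aug.comp T.PiYdd.subtype))
    (ε : M.toEtale.Iso (T.modelMono hη))
    (hker : ∀ x : M.Pi, Rc.projY x = 1 ↔ CycEnvelope.proj T.augY T.chi (ε.e x) = 1)
    {φ ψ : T.PiY →* T.mu} (hφ : ∀ d : T.PiYdd, φ (T.inclYdd d) = 1) (hψ : ∀ d : T.PiYdd, ψ (T.inclYdd d) = 1)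
    {τ τ' : MonoThetaEnv.Iso M M}
    (hτ : ∀ y : M.Pi, ε.e (τ.iso y) =
      CycEnvelope.inMu T.augY T.chi (φ (CycEnvelope.proj T.augY T.chi (ε.e y))) * ε.e y)
    (hτ' : ∀ y : M.Pi, ε.e (τ'.iso y) =
      CycEnvelope.inMu T.augY T.chi (ψ (CycEnvelope.proj T.augY T.chi (ε.e y))) * ε.e y)
    {α : MonoThetaEnv.Iso M M} (h : MuConjugate Rc τ α) (h' : MuConjugate Rc τ' α) : φ = ψ := by
  obtain ⟨m, hm⟩ := h
  obtain ⟨m', hm'⟩ := h'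
  obtain ⟨c, hc⟩ := exists_inMu_eq_of_projY_eq_one Rc ε hker m.2
  obtain ⟨c', hc'⟩ := exists_inMu_eq_of_projY_eq_one Rc ε hker m'.2
  refine T.eq_of_conj_twist_eq haug hφ hψ (c := c) (c' := c') fun z => ?_
  have e := (hm (ε.e.symm z)).symm.trans (hm' (ε.e.symm z))
  have e' := congrArg ε.e e
  rw [map_mul, map_mul, map_inv, map_mul, map_mul, map_inv, hτ, hτ', ContinuousMulEquiv.apply_symm_apply,
    ← hc, ← hc'] at e'
  rw [MulAut.conj_apply, MulAut.conj_apply]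
  exact e'

/-- **[IUTchII] Prop. 1.2 (i), the isomorphism-indeterminacy clause — DISCHARGED modulo the named [EtTh] fact
Cor. 2.18 (iv) (fibres, `ThetaEnvData.Cor218_iv_fibre`).** For an [IUTchII]-typed mono-theta environment `M`
identified with the [EtTh] model (`ε`) over data `T` with `Π^tp_Ÿ ↠ G_K` (`haug`, the `RigidData` axiom
`augYdd_surjective`), and any Def. 1.1 (i) output `R` of `M` whose `Π_M ↠ Π_Y(M)` has the model's kernel: the
automorphisms of `M` acting trivially on `Π_Y(M)` form exactly `1` (`N` odd) resp. `2` (`N` even) `μ_N`-conjugacy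
classes (`Prop12_i_indeterminacy R`). [claim: Mochizuki2012, status: disputed] (IUTchII §1 Prop 1.2 (i), kurims p.25) -/
theorem prop12_i_indeterminacy_of_modelIso (haug : Function.Surjective (T.aug.comp T.PiYdd.subtype))
    (hfib : T.Cor218_iv_fibre) (ε : M.toEtale.Iso (T.modelMono hη))
    (hker : ∀ x : M.Pi, Rc.projY x = 1 ↔ CycEnvelope.proj T.augY T.chi (ε.e x) = 1) :
    Prop12_i_indeterminacy Rc := by
  classical
  -- an automorphism trivial on `Π_Y(M)` reads as a `μ_N`-conjugate of a twist (Cor. 2.18 (iv), fibres)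
  have fibre : ∀ α : MonoThetaEnv.Iso M M, (∀ x : M.Pi, Rc.projY (α.iso x) = Rc.projY x) →
      ∃ (φ : T.PiY →* T.mu) (_ : ∀ d : T.PiYdd, φ (T.inclYdd d) = 1) (c : T.mu), ∀ y : M.Pi,
        ε.e (α.iso y) = MulAut.conj (CycEnvelope.inMu T.augY T.chi c)
          (CycEnvelope.inMu T.augY T.chi (φ (CycEnvelope.proj T.augY T.chi (ε.e y))) * ε.e y) := by
    intro α hα
    obtain ⟨β, hβ⟩ := exists_modelIso ε α
    have hβid : ∀ x, CycEnvelope.proj T.augY T.chi (β.e x) = CycEnvelope.proj T.augY T.chi x := by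
      intro x
      rw [hβ]
      conv_rhs => rw [← ε.e.apply_symm_apply x]
      exact (projY_eq_iff Rc ε hker _ _).mp (hα _)
    obtain ⟨φ, hφ, c, hc⟩ := (hfib η hη).1 β hβid
    refine ⟨φ, hφ, c, fun y => ?_⟩
    rw [← hc, hβ, ContinuousMulEquiv.symm_apply_apply]
  obtain ⟨g₀, hg₀⟩ := T.exists_not_mem_PiYdd
  obtain ⟨τ₁, hτ₁⟩ := exists_iso_twist (hη := hη) ε 1 (fun _ => rfl)
  by_cases hodd : Odd ((S.N : ℕ+) : ℕ)
  · -- `N` odd: one class, that of the identity twist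
    refine ⟨{τ₁}, by rw [if_pos hodd, Finset.card_singleton], ?_, ?_⟩
    · intro α hα x
      rw [Finset.mem_singleton] at hα
      subst hα
      exact projY_twist Rc ε hker hτ₁ x
    · intro α hα
      obtain ⟨φ, hφ, c, hc⟩ := fibre α hα
      have hφ1 : φ = 1 := T.homKill_eq_one_of_odd hodd φ hφ
      subst hφ1
      exact ⟨τ₁, ⟨Finset.mem_singleton_self _, muConjugate_twist Rc ε hker hτ₁ hc⟩,
        fun τ' hτ' => Finset.mem_singleton.mp hτ'.1⟩
  · -- `N` even: two classes, those of the twists by `1` and by `φ₀` (value `ζ` of order `2` off `Π^tp_Ÿ`)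
    obtain ⟨ζ, hζ1, hζ⟩ := T.exists_mu_ne_one_mul_self_eq_one_of_not_odd hodd
    obtain ⟨φ₀, hφ₀, hφ₀g₀⟩ := T.exists_hom_kill_PiYdd ζ hζ
    have hφ₀g₀' : φ₀ g₀ = ζ := hφ₀g₀ g₀ hg₀
    obtain ⟨τ₂, hτ₂⟩ := exists_iso_twist (hη := hη) ε φ₀ hφ₀
    have h10 : (1 : T.PiY →* T.mu) ≠ φ₀ := by
      intro h
      have := DFunLike.congr_fun h g₀
      rw [MonoidHom.one_apply, hφ₀g₀'] at this
      exact hζ1 this.symm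
    have hne : τ₁ ≠ τ₂ := by
      intro h
      have e1 := hτ₁ (ε.e.symm (CycEnvelope.algSection T.augY T.chi g₀))
      have e2 := hτ₂ (ε.e.symm (CycEnvelope.algSection T.augY T.chi g₀))
      rw [h, e2, ContinuousMulEquiv.apply_symm_apply, MonoidHom.one_apply, map_one, one_mul] at e1
      have e3 := mul_right_cancel (e1.trans (one_mul _).symm)
      have hp : CycEnvelope.proj T.augY T.chi (CycEnvelope.algSection T.augY T.chi g₀) = g₀ := rfl
      rw [hp, hφ₀g₀', ← (CycEnvelope.inMu T.augY T.chi).map_one] at e3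
      exact hζ1 (SemidirectProduct.inl_injective e3)
    refine ⟨{τ₁, τ₂}, by rw [if_neg hodd, Finset.card_pair hne], ?_, ?_⟩
    · intro α hα x
      rw [Finset.mem_insert, Finset.mem_singleton] at hα
      rcases hα with rfl | rfl
      · exact projY_twist Rc ε hker hτ₁ x
      · exact projY_twist Rc ε hker hτ₂ x
    · intro α hα
      obtain ⟨φ, hφ, c, hc⟩ := fibre α hα
      rcases T.homKill_eq_one_or_eq hζ1 hζ hg₀ hφ₀ hφ₀g₀' φ hφ with rfl | rfl
      · refine ⟨τ₁, ⟨by simp, muConjugate_twist Rc ε hker hτ₁ hc⟩, fun τ' hτ' => ?_⟩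
        rcases Finset.mem_insert.mp hτ'.1 with h | h
        · exact h
        · rw [Finset.mem_singleton] at h
          subst h
          exact absurd (eq_of_muConjugate_twist Rc haug ε hker (fun _ => rfl) hφ₀ hτ₁ hτ₂
            (muConjugate_twist Rc ε hker hτ₁ hc) hτ'.2) h10
      · refine ⟨τ₂, ⟨by simp, muConjugate_twist Rc ε hker hτ₂ hc⟩, fun τ' hτ' => ?_⟩
        rcases Finset.mem_insert.mp hτ'.1 with h | h
        · subst h
          exact absurd (eq_of_muConjugate_twist Rc haug ε hker (fun _ => rfl) hφ₀ hτ₁ hτ₂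
            hτ'.2 (muConjugate_twist Rc ε hker hτ₂ hc)) h10
        · exact Finset.mem_singleton.mp h

end Model

/-! ## Over a `ModelFrame`: the Prop. 1.2 (i), (ii) OUTPUTS exhibited -/

section Frame

variable {S : ThetaSetting.{u}} {l : ℕ} {R : RigidData.{u} S.N l}

/-- **[IUTchII] Prop. 1.2 (i), indeterminacy clause, for abc-iut-L6-d6's Def. 1.1 (i) output of the model**
(`ModelFrame.reconstruction`): DISCHARGED modulo the named [EtTh] fact `RigidData.Cor218_iv_fibre`.
[claim: Mochizuki2012, status: disputed] (IUTchII §1 Prop 1.2 (i), kurims p.25) -/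
theorem prop12_i_indeterminacy_reconstruction (F : ModelFrame S R) (hfib : R.Cor218_iv_fibre)
    {η : R.PiYdd → R.mu} (hη : η ∈ R.thetaCocycles) {M : MonoThetaEnv S}
    (ε : M.toEtale.Iso (R.modelMono hη)) : Prop12_i_indeterminacy (F.reconstruction ε.e) :=
  prop12_i_indeterminacy_of_modelIso (F.reconstruction ε.e) R.augYdd_surjective
    ((RigidData.cor218_iv_fibre_iff R).mp hfib) ε (fun _ => Iff.rfl)

/-- **[IUTchII] Prop. 1.2 (i) — the OUTPUT EXHIBITED, with its indeterminacy clause, modulo the named [EtTh] fact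
Cor. 2.18 (iv)** (`RigidData.Cor218_iv_fibre`): over an [EtTh] rigidity interface `R` framed in the setting `S`
(`ModelFrame`, bridge B8 part 5b) whose model is the reference model of `S` (`ModelAgreement`, bridge B8 part 1),
for every topological group `Π` isomorphic to `Π^tp_{X̲̲_k}` and every mono-theta environment `M` of `S` there is an
`EnvOfGroup S Π` with `M^Θ(Π) = M` — `Π_X(M^Θ(Π)) = Π^tp_X ≅ Π^tp_{X̲̲_k} ≅ Π` — whose Def. 1.1 (i) output has the
printed isomorphism indeterminacy (`1` resp. `2` `μ_N`-conjugacy classes).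
[claim: Mochizuki2012, status: disputed] (IUTchII §1 Prop 1.2 (i), kurims p.25) -/
theorem exists_envOfGroup (F : ModelFrame S R) (A : ModelAgreement S R.toThetaEnvData)
    (hfib : R.Cor218_iv_fibre) (M : MonoThetaEnv S) (P : TopGroup.{u}) (h : Nonempty (P ≃ₜ* S.PiX)) :
    ∃ E : EnvOfGroup S P, E.env = M ∧ Prop12_i_indeterminacy E.recon := by
  obtain ⟨α⟩ := M.nonempty_toEtale_iso_modelEnv
  exact ⟨⟨h, M, F.reconstruction (etaleIsoTrans α A.iso).e, h.some.trans F.eX.symm⟩, rfl,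
    prop12_i_indeterminacy_reconstruction F hfib A.mem (etaleIsoTrans α A.iso)⟩

/-- The same, **modulo [EtTh] Prop. 2.14 (i)** (`RigidData.Prop214_i`) in place of Cor. 2.18 (iv): L2's PROVED
implication `RigidData.cor218_iv_fibre_of_prop214_i` (abc-iut-L2-t10) supplies the fibre description.
[claim: Mochizuki2012, status: disputed] (IUTchII §1 Prop 1.2 (i), kurims p.25) -/
theorem exists_envOfGroup_of_prop214_i (F : ModelFrame S R) (A : ModelAgreement S R.toThetaEnvData)
    (h214 : R.Prop214_i) (M : MonoThetaEnv S) (P : TopGroup.{u}) (h : Nonempty (P ≃ₜ* S.PiX)) :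
    ∃ E : EnvOfGroup S P, E.env = M ∧ Prop12_i_indeterminacy E.recon :=
  exists_envOfGroup F A (R.cor218_iv_fibre_of_prop214_i h214) M P h

/-- **Prop. 1.2 (i) for the [IUTchII] §1 setting BUILT from `R`** (bridge B8 part 2 `ThetaSetting.ofThetaEnvData`;
in particular the Tate-curve setting `ThetaSetting.ofDoubleUnderline` of part 3): there `ModelAgreement` holds by
construction (`modelAgreement_ofThetaEnvData`), so the frame `ModelFrame` and the named fact `Cor218_iv_fibre` are
the only inputs. [claim: Mochizuki2012, status: disputed] (IUTchII §1 Prop 1.2 (i), kurims p.25) -/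
theorem exists_envOfGroup_ofThetaEnvData {N : ℕ+} {l' : ℕ} {R' : RigidData.{u} N l'} [TopologicalSpace R'.G]
    [IsTopologicalGroup R'.G] (X : ThetaSetting.SideData R'.toThetaEnvData)
    (F : ModelFrame (ThetaSetting.ofThetaEnvData R'.toThetaEnvData X) R') (hfib : R'.Cor218_iv_fibre)
    (M : MonoThetaEnv (ThetaSetting.ofThetaEnvData R'.toThetaEnvData X)) (P : TopGroup.{u})
    (h : Nonempty (P ≃ₜ* (ThetaSetting.ofThetaEnvData R'.toThetaEnvData X).PiX)) :
    ∃ E : EnvOfGroup (ThetaSetting.ofThetaEnvData R'.toThetaEnvData X) P,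
      E.env = M ∧ Prop12_i_indeterminacy E.recon :=
  exists_envOfGroup F (ThetaSetting.modelAgreement_ofThetaEnvData R'.toThetaEnvData X) hfib M P h

/-- **[IUTchII] Prop. 1.2 (ii) — the OUTPUT EXHIBITED** over a `ModelFrame`: for every instance `F` of the typer's
interface `TemperedFrobenioidData S` ("`𝒞` … with base category `𝒟` equivalent to `B^temp(Π^tp_{X̲̲_k})⁰`") and every
mono-theta environment `M` of `S`, an `EnvOfFrobenioid F` with `M^Θ(𝒞) = M`: its Def. 1.1 (i) output is the one of
bridge B8 part 5b and `𝒟 ≌ B^temp(Π^tp_{X̲̲_k})⁰ ≌ B^temp(Π_X(M))⁰` (transport of the interface equivalence along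
`Π^tp_{X̲̲_k} ≅ Π^tp_X = Π_X(M)`). HONEST NOTE: over this interface the output carries no further property clause
(typer's docstring, review of p405599); the Frobenioid-theoretic content of Prop. 1.2 (ii) is [EtTh] Thm. 5.10 (iii)
(node `EtTh:Thm5.10(iii)`), not re-proved here. [claim: Mochizuki2012, status: disputed] (IUTchII §1 Prop 1.2 (ii), kurims pp.25-26) -/
theorem exists_envOfFrobenioid (F : ModelFrame S R) {M₀ : MonoThetaEnv S} (e₀ : M₀.Pi ≃ₜ* R.env)
    (Fr : TemperedFrobenioidData S) (M : MonoThetaEnv S) :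
    ∃ E : EnvOfFrobenioid Fr, E.env = M := by
  obtain ⟨α⟩ := MonoThetaEnv.nonempty_iso M₀ M
  exact ⟨⟨M, (F.reconstruction e₀).transport α, Fr.baseEquiv.trans (Fr.Btemp0_map F.eX.symm)⟩, rfl⟩

/-- **[IUTchII] Prop. 1.2 (ii) output together with the Prop. 1.2 (i) indeterminacy clause** for the SAME
mono-theta environment (modulo `RigidData.Cor218_iv_fibre`): `M^Θ(𝒞) = M` with a Def. 1.1 (i) output satisfying
`Prop12_i_indeterminacy`. [claim: Mochizuki2012, status: disputed] (IUTchII §1 Prop 1.2 (ii), kurims pp.25-26) -/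
theorem exists_envOfFrobenioid_indeterminacy (F : ModelFrame S R) (A : ModelAgreement S R.toThetaEnvData)
    (hfib : R.Cor218_iv_fibre) (Fr : TemperedFrobenioidData S) (M : MonoThetaEnv S) :
    ∃ E : EnvOfFrobenioid Fr, E.env = M ∧ Prop12_i_indeterminacy E.recon := by
  obtain ⟨α⟩ := M.nonempty_toEtale_iso_modelEnv
  exact ⟨⟨M, F.reconstruction (etaleIsoTrans α A.iso).e, Fr.baseEquiv.trans (Fr.Btemp0_map F.eX.symm)⟩, rfl,
    prop12_i_indeterminacy_reconstruction F hfib A.mem (etaleIsoTrans α A.iso)⟩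

end Frame

end Literature.IUT.HodgeArakelov
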